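import Mathlib
import HarnessLib

/-!
# `RationalShortRootRigidity` — Step 1 helper (m12c): vanishing on a real hyperplane ⇒ divisibility by its linear form

Helper lemma INSIDE the paper proof of crux `stmt-QuantumFields-23124` (`F4SubCurvatureDoor.RationalShortRootRigidity`,
LINE g15-A of planner ym-idea-3; Step 1 = `stub_reduce`; free-hands menu IV, item (m12c), statement typed in
HOME l15/Helpers23124c.lean as `Helpers.HyperplaneVanishingDivides` — proved here DEF-FREE with that body verbatim; the
`n`-variable version of the plane lemma `X_one_sub_C_mul_X_zero_dvd`, p663544):

**Lemma** (`hyperplaneVanishingDivides`).  Let `F ∈ ℝ[x₀,…,x_{n−1}]` and `a ∈ ℝⁿ ∖ {0}`.  If `F(v) = 0` whenever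
`Σ aᵢvᵢ = 0`, then `ℓ := Σ aᵢ Xᵢ` divides `F`.

Proof.  Pick `j` with `aⱼ ≠ 0` and substitute `Xⱼ ↦ aⱼ⁻¹(Xⱼ − Σ_{i≠j} aᵢXᵢ)` (`ψ'`); the inverse substitution `ψ : Xⱼ ↦ ℓ`
satisfies `ψ(ψ'F) = F` (`MvPolynomial.algHom` computation on generators).  The polynomial `G = ψ'F` vanishes whenever `vⱼ = 0`
(the substituted point lies on the hyperplane), hence `Xⱼ ∣ G` (`X_dvd_of_eval_eq_zero`: swap `j` to the front, read `G` in
`ℝ[rest][Xⱼ]` by `finSuccEquiv`, `Polynomial.X_dvd_iff`, and the constant coefficient vanishes pointwise, so it is `0` by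
`MvPolynomial.funext`); applying `ψ` gives `ℓ ∣ F`.

Mathlib only; THEOREMS ONLY (no definitions); no named facts; no `sorry`; default heartbeats.  Nothing about the crux 23124, the
route's rung or the Yang–Mills mass gap is proved here.  Free-hands seat `ym-line-frs-p2` g10 (announced on the owner's bus
2026-08-28T20:28Z), `--supports stmt-QuantumFields-23124`.
-/

set_option autoImplicit false

namespace Summit.QuantumFields.YangMills.Theorems.RationalShortRootRigidity

open scoped BigOperators

/-! ## 1. Divisibility by a variable from vanishing on its coordinate hyperplane -/

/-- `eval v (bind₁ h φ) = eval (i ↦ eval v (h i)) φ` (any index type). [folklore] -/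
theorem eval_bind₁_gen {σ : Type*} (v : σ → ℝ) (h : σ → MvPolynomial σ ℝ) (φ : MvPolynomial σ ℝ) :
    MvPolynomial.eval v (MvPolynomial.bind₁ h φ) = MvPolynomial.eval (fun i => MvPolynomial.eval v (h i)) φ :=
  MvPolynomial.eval₂Hom_bind₁ _ _ _ _

/-- A real polynomial vanishing whenever `v 0 = 0` is divisible by `X 0`. [folklore] -/
theorem X_zero_dvd_of_eval_eq_zero {m : ℕ} (G : MvPolynomial (Fin (m + 1)) ℝ)
    (h : ∀ v : Fin (m + 1) → ℝ, v 0 = 0 → MvPolynomial.eval v G = 0) : MvPolynomial.X 0 ∣ G := by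
  have hc : (MvPolynomial.finSuccEquiv ℝ m G).coeff 0 = 0 := by
    apply MvPolynomial.funext
    intro s
    rw [map_zero, ← Polynomial.coeff_map, Polynomial.coeff_zero_eq_eval_zero, ← MvPolynomial.eval_eq_eval_mv_eval']
    exact h _ (Fin.cons_zero _ _)
  have hX : Polynomial.X ∣ MvPolynomial.finSuccEquiv ℝ m G := Polynomial.X_dvd_iff.2 hc
  rw [← map_dvd_iff (MvPolynomial.finSuccEquiv ℝ m), MvPolynomial.finSuccEquiv_X_zero]
  exact hX

/-- A real polynomial vanishing whenever `v j = 0` is divisible by `X j`. [folklore] -/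
theorem X_dvd_of_eval_eq_zero {m : ℕ} (G : MvPolynomial (Fin (m + 1)) ℝ) (j : Fin (m + 1))
    (h : ∀ v : Fin (m + 1) → ℝ, v j = 0 → MvPolynomial.eval v G = 0) : MvPolynomial.X j ∣ G := by
  set e := MvPolynomial.renameEquiv ℝ (Equiv.swap (0 : Fin (m + 1)) j) with he
  have h' : ∀ v : Fin (m + 1) → ℝ, v 0 = 0 → MvPolynomial.eval v (e G) = 0 := by
    intro v hv
    rw [he, MvPolynomial.renameEquiv_apply, MvPolynomial.eval_rename]
    apply h
    rw [Function.comp_apply, Equiv.swap_apply_right]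
    exact hv
  have hdvd := X_zero_dvd_of_eval_eq_zero (e G) h'
  rw [← map_dvd_iff e, he, MvPolynomial.renameEquiv_apply, MvPolynomial.rename_X, Equiv.swap_apply_right]
  exact hdvd

/-! ## 2. The hyperplane lemma -/

/-- **Vanishing on a real hyperplane implies divisibility by its linear form** (m12c; Step 1 of the paper proof of 23124).
The statement is the body of `Helpers.HyperplaneVanishingDivides` (HOME l15/Helpers23124c.lean) verbatim. [folklore] -/
theorem hyperplaneVanishingDivides :
    ∀ (n : ℕ) (F : MvPolynomial (Fin n) ℝ) (a : Fin n → ℝ), a ≠ 0 →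
      (∀ v : Fin n → ℝ, ∑ i, a i * v i = 0 → MvPolynomial.eval v F = 0) →
      (∑ i, MvPolynomial.C (a i) * MvPolynomial.X i) ∣ F := by
  intro n F a ha hF
  obtain ⟨j, hj⟩ : ∃ j, a j ≠ 0 := by
    by_contra h
    exact ha (funext fun i => not_not.1 fun hi => h ⟨i, hi⟩)
  obtain ⟨m, rfl⟩ : ∃ m, n = m + 1 := ⟨n - 1, (Nat.succ_pred_eq_of_pos (Fin.pos j)).symm⟩
  -- the linear form splits as `C aⱼ · Xⱼ + ℓ'`
  set ℓ' : MvPolynomial (Fin (m + 1)) ℝ := ∑ i ∈ Finset.univ.erase j, MvPolynomial.C (a i) * MvPolynomial.X i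
    with hℓ'
  have hℓ : ∑ i, MvPolynomial.C (a i) * MvPolynomial.X i = MvPolynomial.C (a j) * MvPolynomial.X j + ℓ' :=
    (Finset.add_sum_erase _ _ (Finset.mem_univ j)).symm
  -- the substitutions `ψ : Xⱼ ↦ ℓ` and `ψ' : Xⱼ ↦ aⱼ⁻¹ (Xⱼ − ℓ')` (other variables fixed)
  set f : Fin (m + 1) → MvPolynomial (Fin (m + 1)) ℝ := fun i =>
    if i = j then ∑ i, MvPolynomial.C (a i) * MvPolynomial.X i else MvPolynomial.X i with hf
  set g : Fin (m + 1) → MvPolynomial (Fin (m + 1)) ℝ := fun i =>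
    if i = j then MvPolynomial.C (a j)⁻¹ * (MvPolynomial.X j - ℓ') else MvPolynomial.X i with hg
  have hfj : f j = MvPolynomial.C (a j) * MvPolynomial.X j + ℓ' := by rw [← hℓ, hf]; exact if_pos rfl
  have hfi : ∀ i, i ≠ j → f i = MvPolynomial.X i := fun i hi => by rw [hf]; exact if_neg hi
  have hgj : g j = MvPolynomial.C (a j)⁻¹ * (MvPolynomial.X j - ℓ') := by rw [hg]; exact if_pos rfl
  have hgi : ∀ i, i ≠ j → g i = MvPolynomial.X i := fun i hi => by rw [hg]; exact if_neg hi
  have hfℓ' : MvPolynomial.aeval f ℓ' = ℓ' := by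
    rw [hℓ', map_sum]
    refine Finset.sum_congr rfl fun i hi => ?_
    rw [map_mul, MvPolynomial.aeval_C, MvPolynomial.aeval_X, MvPolynomial.algebraMap_eq, hfi i (Finset.ne_of_mem_erase hi)]
  have hcomp : ∀ i, MvPolynomial.aeval f (g i) = MvPolynomial.X i := by
    intro i
    by_cases hi : i = j
    · rw [hi, hgj, map_mul, MvPolynomial.aeval_C, map_sub, MvPolynomial.aeval_X, hfℓ', MvPolynomial.algebraMap_eq, hfj,
        add_sub_cancel_right, ← mul_assoc, ← map_mul, inv_mul_cancel₀ hj, map_one, one_mul]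
    · rw [hgi i hi, MvPolynomial.aeval_X, hfi i hi]
  -- `ψ (ψ' F) = F`
  have hFG : MvPolynomial.aeval f (MvPolynomial.aeval g F) = F := by
    rw [MvPolynomial.comp_aeval_apply]
    have : (fun i => MvPolynomial.aeval f (g i)) = MvPolynomial.X := funext hcomp
    rw [this, MvPolynomial.aeval_X_left_apply]
  -- `G = ψ' F` vanishes on `{v j = 0}`
  have hG : ∀ v : Fin (m + 1) → ℝ, v j = 0 → MvPolynomial.eval v (MvPolynomial.aeval g F) = 0 := by
    intro v hv
    rw [show MvPolynomial.aeval g F = MvPolynomial.bind₁ g F from rfl, eval_bind₁_gen]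
    apply hF
    -- the substituted point lies on the hyperplane
    have hevℓ' : MvPolynomial.eval v ℓ' = ∑ i ∈ Finset.univ.erase j, a i * v i := by
      rw [hℓ', map_sum]
      refine Finset.sum_congr rfl fun i _ => ?_
      rw [map_mul, MvPolynomial.eval_C, MvPolynomial.eval_X]
    rw [← Finset.add_sum_erase _ _ (Finset.mem_univ j), hgj, map_mul, MvPolynomial.eval_C, map_sub,
      MvPolynomial.eval_X, hevℓ', hv, zero_sub]
    have hrest : ∑ i ∈ Finset.univ.erase j, a i * MvPolynomial.eval v (g i) = ∑ i ∈ Finset.univ.erase j, a i * v i := by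
      refine Finset.sum_congr rfl fun i hi => ?_
      rw [hgi i (Finset.ne_of_mem_erase hi), MvPolynomial.eval_X]
    rw [hrest, ← mul_assoc, mul_inv_cancel₀ hj, one_mul, neg_add_cancel]
  -- `Xⱼ ∣ ψ' F`, hence `ℓ = ψ Xⱼ ∣ ψ (ψ' F) = F`
  obtain ⟨Q, hQ⟩ := X_dvd_of_eval_eq_zero _ j hG
  refine ⟨MvPolynomial.aeval f Q, ?_⟩
  conv_lhs => rw [← hFG, hQ, map_mul, MvPolynomial.aeval_X, hfj, ← hℓ]

end Summit.QuantumFields.YangMills.Theorems.RationalShortRootRigidity
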